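import Literature.Probability.Percolation.TriLowestCrossing
import HarnessLib

/-!
# The closed transversal through the exploration sequence (Kesten–Sidoravicius–Zhang)

Topic: Probability / Percolation; family `crit-perc` (site percolation on the triangular lattice
`𝕋 = triGraph`). A brick of the arm-separation theorem of Nolin (2008, Thm. 11 [arXiv
0711.4948: Thm. 10]) for an ARBITRARY number of arms of the same colour landing in one
sub-domain, towards `Literature.Probability.Percolation.Nolin2008_prop17_quasiMult`
(`FiveArmExponentFacts.lean`).

In the abstract setting of `TriLowestCrossing.lean` (a `JDomain Q`: crossings from the start set
`F` to the tip arc `J`, the region `above` a crossing, the lowest open crossing `lowest ω` and the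
exploration sequence `lowestSeq ω 0 < lowestSeq ω 1 < ⋯` of greedy lowest open crossings, under
the planar hypotheses `CutProp` and `DualProp`) we prove the deterministic fact behind
Kesten–Sidoravicius–Zhang's rerouting of disjoint occupied crossings onto the greedy family
(KSZ 1998, Appendix, (7.10) and the paragraph following it, p. 27):

> "there exists a path `τ` which connects the top and bottom edge of `S_R` in `S_R` such that `τ`
> intersects each `r_i` in exactly one vertex `v_i`, and except for these vertices `v_i`, `τ` is
> vacant. To see that such a `τ` can be found, recall that `r_1, …, r_ν` are all the disjoint
> `r_i`. Then by Proposition 2.2 of Kesten (1982) there exists a vacant path in `S_R` from some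
> vertex `w_ν` in the top edge of `S_R` to a vertex `u_ν` which is adjacent to some `v_ν ∈ r_ν`.
> If we have found `v_j ∈ r_j` for `j ≥ i`, then again by Proposition 2.2 of Kesten (1982) there
> exists a vacant path from some neighbor `w_i` of `v_i` to a neighbor `u_{i-1}` of `r_{i-1}`.
> The vacant piece from `w_i` to `u_{i-1}` lies below `r_i` and above `r_{i-1}`. The
> concatenation of the pieces … give the desired path `τ`."

and its use: "`τ` separates the left edge of `S_R` from its right edge, so that each `s_q` must
intersect `τ` in some point. Since `s_q` is occupied this intersection must be at one of the
`v_i`. … the piece of `s_q` till it reaches `v_{i_q}` lies to the 'left of `τ`' and cannot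
intersect the piece of some `r_j` … from `v_j` to `a(r_j)`, because this lies to the 'right of
`τ`'."

## Main results (namespace `JDomain`, hypotheses `CutProp`, `DualProp`)

* `exists_closed_path_to_lowest` — **the duality step at the lowest crossing** (the rôle of
  Kesten 1982, Prop. 2.2 in the quotation, made precise for the potential-minimising `lowest`):
  if `lowest ω = (c, z)` and `x ∈ c` is adjacent to the region above `c` (or lies on `Tp`), then
  `x ∈ Bt` or a closed path of `below c` joins `Bt` to a neighbour of `x`. (Duality applied to the
  open sites on-or-below `c` other than `x`: an open `F–J` path there would contain an open
  crossing of strictly smaller potential.)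
* `exists_closed_path_from_Tp`, `exists_closed_path_between`, `exists_closed_path_from_Bt` —
  the top piece (from `Tp` down to the last term), the piece between consecutive terms, and the
  bottom piece (from the first term to `Bt`) of `τ`, each closed off its endpoints on the terms,
  each landing at a site of the lower term adjacent to the region above that term.
* `exists_transversal` — **the transversal**: if the exploration sequence of `ω` stops
  (`lowestSeq ω t = none`), there are a set `T ⊆ D` carrying a `𝕋`-path from `Bt` to `Tp` and
  junctions `v u`, one on each term, such that every OPEN site of `T` is one of the junctions
  and every junction lies on `T` and on its term.
* `not_pathIn_sdiff_of_transversal` — **`τ` separates `F` from `J`**: no `𝕋`-path of `D ∖ T`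
  joins `F` to `J` (it would contain a crossing disjoint from the `Bt–Tp` path `T`, against
  `CutProp`); `ne_and_not_adj_of_transversal` — hence a site joined to `F` inside `D ∖ T` and a
  site joined to `J` inside `D ∖ T` are distinct and not adjacent ("left of `τ`" / "right of
  `τ`").

Colours: "open" means `∈ ω`; the closed version is obtained by applying the results to `ωᶜ`.

## References

* H. Kesten, V. Sidoravicius, Y. Zhang, *Almost all words are seen in critical site percolation
  on the triangular lattice*, Electron. J. Probab. 3 (1998), paper 10, Appendix §7, (7.9)–(7.10)
  and p. 27. [KestenSidoraviciusZhang1998]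
* H. Kesten, *Percolation theory for mathematicians*, Birkhäuser (1982), §2.2 Prop. 2.2, §2.3
  Prop. 2.3. [KestenPTM1982]
* P. Nolin, *Near-critical percolation in two dimensions*, Electron. J. Probab. 13 (2008), §4.4,
  Lemma 15 [arXiv 0711.4948: Lemma 14]. [Nolin2008]

Mathlib search: no percolation / crossing notions in Mathlib; tree: `JDomain`, `lowest`,
`lowestSeq`, `exists_crossing_subset`, `above_subset_above_of_subset_envelope`
(`TriLowestCrossing.lean`), `PathIn.exit`, `PathIn.last_exit_or` (`SitePaths.lean`).
-/

noncomputable section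

namespace Literature.Probability.Percolation

open LatticeModels

namespace JDomain

variable {Q : JDomain}

variable {ω : Set (Site 2)} {c c' a : Finset (Site 2)} {z z' w x : Site 2} {u t : ℕ}

/-! ### The duality step at the lowest crossing -/

/-- If the crossing `a` lies on or below the crossing `c`, the region above `c` is part of the
region above `a`. [cite: KestenPTM1982, §2.3] -/
theorem above_subset_above_of_subset_lower (hc : Q.IsCrossing c z) (ha : Q.IsCrossing a w)
    (hsub : a ⊆ Q.lower c z) : Q.above c z ⊆ Q.above a w := by
  refine above_subset_above_of_subset_envelope (K' := a) (z' := w) hc ha fun v hv => ?_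
  exact Finset.mem_union_right _
    (Finset.mem_sdiff.2 ⟨hv, (mem_lower_iff_not_mem_above (ha.subset hv)).1 (hsub hv)⟩)

/-- There is no open crossing at all iff duality produces a CLOSED path from `Bt` to `Tp`
(Kesten 1982, Prop. 2.2, for the configuration `ω`). [cite: KestenPTM1982, §2.2 Prop. 2.2] -/
theorem exists_closed_path_of_lowest_eq_none (hdual : Q.DualProp) (h : Q.lowest ω = none) :
    ∃ s ∈ Q.Bt, ∃ e ∈ Q.Tp, PathIn triGraph {y | y ∈ Q.D ∧ y ∉ ω} s e := by
  classical
  set S : Finset (Site 2) := Q.D.filter fun y => y ∈ ω with hS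
  have hSD : S ⊆ Q.D := Finset.filter_subset _ _
  rcases hdual S hSD with ⟨f, hf, t, ht, hq⟩ | ⟨s, hs, e, he, hq⟩
  · exfalso
    obtain ⟨a, w, ha, haS⟩ := exists_crossing_subset hSD hf ht hq
    have haω : (↑a : Set (Site 2)) ⊆ ω := fun v hv =>
      (Finset.mem_filter.1 (haS (Finset.mem_coe.1 hv))).2
    exact lowest_eq_none_iff.1 h a w ha haω
  · refine ⟨s, hs, e, he, hq.mono fun v hv => ?_⟩
    have hv' : v ∈ Q.D ∧ v ∉ S := by simpa using hv
    exact ⟨hv'.1, fun hvω => hv'.2 (Finset.mem_filter.2 ⟨hv'.1, hvω⟩)⟩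

/-- **The duality step at the lowest open crossing** (the use of Kesten 1982, Prop. 2.2 in KSZ
1998, App. (7.10), made precise for the potential-minimising lowest crossing): if
`lowest ω = (c, z)` and the site `x ∈ c` is adjacent to the region above `c`, or lies on the
upper arc `Tp`, then either `x ∈ Bt`, or some closed `𝕋`-path of the region below `c` joins a
site of `Bt` to a neighbour of `x`. Proof: apply `DualProp` to the set `S` of open sites on or
below `c` other than `x`; an `F–J` path inside `S` would contain an open crossing `a ⊆ lower c`
missing `x`, whose region above contains `above c` and `x`, ie of strictly smaller potential —
contradicting minimality; so there is a `Bt–Tp` path avoiding `S`, and its initial segment up to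
its first site outside the closed part of `below c` is the required path (that site is adjacent
to `below c`, hence not above `c`, and is on-or-below `c`, open or on `c`, and not in `S`: it
is `x`). [cite: KestenSidoraviciusZhang1998, App. §7 (7.10) p. 27] -/
theorem exists_closed_path_to_lowest (hcut : Q.CutProp) (hdual : Q.DualProp)
    (h : Q.lowest ω = some (c, z)) (hx : x ∈ c)
    (hgood : (∃ y ∈ Q.above c z, triGraph.Adj x y) ∨ x ∈ Q.Tp) :
    x ∈ Q.Bt ∨ ∃ s ∈ Q.Bt, ∃ y, triGraph.Adj y x ∧
      PathIn triGraph {v | v ∈ Q.below c z ∧ v ∉ ω} s y := by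
  classical
  obtain ⟨hp, hmin⟩ := lowest_eq_some_iff.1 h
  obtain ⟨hc, hcω⟩ := mem_openCrossings.1 hp
  dsimp only at hc hcω
  -- `S`: the open sites on or below `c`, other than `x`
  set S : Finset (Site 2) := (Q.lower c z).filter fun v => v ∈ ω ∧ v ≠ x with hS
  have hmemS : ∀ {v}, v ∈ S ↔ v ∈ Q.lower c z ∧ v ∈ ω ∧ v ≠ x := fun {v} => by
    simp [hS, Finset.mem_filter]
  have hSD : S ⊆ Q.D := fun v hv => lower_subset_D hc.subset (hmemS.1 hv).1
  rcases hdual S hSD with ⟨f, hf, t, ht, hq⟩ | ⟨s, hs, e, he, hq⟩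
  · -- an open crossing inside `S` has strictly smaller potential than `c`
    exfalso
    obtain ⟨a, w, ha, haS⟩ := exists_crossing_subset hSD hf ht hq
    have haω : (↑a : Set (Site 2)) ⊆ ω := fun v hv => (hmemS.1 (haS (Finset.mem_coe.1 hv))).2.1
    have hal : a ⊆ Q.lower c z := fun v hv => (hmemS.1 (haS hv)).1
    have hxa : x ∉ a := fun hxa => (hmemS.1 (haS hxa)).2.2 rfl
    have hAA : Q.above c z ⊆ Q.above a w := above_subset_above_of_subset_lower hc ha hal
    have hxD : x ∈ Q.D := hc.subset hx
    have hxA : x ∈ Q.above a w := by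
      rcases hgood with ⟨y, hy, hxy⟩ | hxT
      · exact mem_above_of_adj (hAA hy) hxD hxa hxy.symm
      · exact ha.mem_above_of_mem_Tp hxT hxa
    have hxnA : x ∉ Q.above c z := fun h' => not_mem_of_mem_above h' hx
    have hlt : Q.pot a w < Q.pot c z := by
      unfold pot
      apply Finset.card_lt_card
      refine (Finset.ssubset_iff_of_subset
        (Finset.sdiff_subset_sdiff (Finset.Subset.refl _) hAA)).2 ⟨x, ?_, ?_⟩
      · exact Finset.mem_sdiff.2 ⟨hxD, hxnA⟩
      · exact fun h' => (Finset.mem_sdiff.1 h').2 hxA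
    have hle : Q.key (c, z) ≤ Q.key (a, w) := hmin (a, w) (mem_openCrossings.2 ⟨ha, haω⟩)
    rw [key, key, Prod.Lex.le_iff] at hle
    simp only [ofLex_toLex] at hle
    omega
  · -- a `Bt–Tp` path avoiding `S`
    by_cases hsx : s = x
    · exact Or.inl (hsx ▸ hs)
    right
    have hmem : ∀ {v}, v ∈ (↑(Q.D \ S) : Set (Site 2)) ↔ v ∈ Q.D ∧ v ∉ S := fun {v} => by simp
    have hsD : s ∈ Q.D := Q.Bt_subset hs
    have hsl : s ∈ Q.lower c z := (mem_lower_iff_not_mem_above hsD).2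
      (hc.not_mem_above_of_mem_Bt_union hcut (Finset.mem_union_left _ hs))
    have hsS : s ∉ S := (hmem.1 hq.left_mem).2
    have hsω : s ∉ ω := fun hsω => hsS (hmemS.2 ⟨hsl, hsω, hsx⟩)
    have hsc : s ∉ c := fun hsc => hsω (hcω (Finset.mem_coe.2 hsc))
    have hsb : s ∈ Q.below c z := (mem_lower.1 hsl).resolve_left hsc
    set R : Set (Site 2) := {v | v ∈ Q.below c z ∧ v ∉ ω} with hR
    have hsR : s ∈ R := ⟨hsb, hsω⟩
    have heR : e ∉ R := by
      rintro ⟨heb, -⟩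
      exact (mem_below.1 heb).2.2 (hc.mem_above_of_mem_Tp he (mem_below.1 heb).2.1)
    obtain ⟨a, b, haR, hbR, hbDS, hab, hpa⟩ := hq.exit hsR heR
    have hbD : b ∈ Q.D := (hmem.1 hbDS).1
    have hbS : b ∉ S := (hmem.1 hbDS).2
    -- the exit site is `x`
    have hbx : b = x := by
      rcases mem_or_mem_above_or_mem_below (c := c) (z := z) hbD with hbc | hbA | hbB
      · by_contra hne
        exact hbS (hmemS.2 ⟨mem_lower.2 (Or.inl hbc), hcω (Finset.mem_coe.2 hbc), hne⟩)
      · exact absurd hab.symm (not_adj_above_below hbA haR.1)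
      · by_contra hne
        have hbω : b ∈ ω := by
          by_contra hbω
          exact hbR ⟨hbB, hbω⟩
        exact hbS (hmemS.2 ⟨mem_lower.2 (Or.inr hbB), hbω, hne⟩)
    rw [hbx] at hab
    exact ⟨s, hs, a, hab, hpa.mono Set.inter_subset_left⟩

/-! ### The pieces of the transversal -/

/-- **Top piece.** If the exploration sequence stops after the term `(c, z) = lowestSeq ω u`,
some site `x ∈ c`, adjacent to the region above `c` or on `Tp`, is joined to `Tp` by a path all
of whose sites other than `x` are closed sites above `c` ("by Proposition 2.2 of Kesten (1982)
there exists a vacant path in `S_R` from some vertex `w_ν` in the top edge of `S_R` to a vertex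
`u_ν` which is adjacent to some `v_ν ∈ r_ν`"). [cite: KestenSidoraviciusZhang1998, App. §7 (7.10) p. 27] -/
theorem exists_closed_path_from_Tp (hcut : Q.CutProp) (hdual : Q.DualProp)
    (h : Q.lowestSeq ω u = some (c, z)) (hnone : Q.lowestSeq ω (u + 1) = none) :
    ∃ x ∈ c, ((∃ y ∈ Q.above c z, triGraph.Adj x y) ∨ x ∈ Q.Tp) ∧
      ∃ e ∈ Q.Tp, PathIn triGraph ({y | y ∈ Q.above c z ∧ y ∉ ω} ∪ {x}) e x := by
  classical
  have hc := (isCrossing_of_lowestSeq h).1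
  rw [lowestSeq_succ_of_eq_some h] at hnone
  obtain ⟨s, hs, e, he, hq⟩ := exists_closed_path_of_lowest_eq_none hdual hnone
  have hsD : s ∈ Q.D := Q.Bt_subset hs
  have hsl : s ∈ Q.lower c z := (mem_lower_iff_not_mem_above hsD).2
    (hc.not_mem_above_of_mem_Bt_union hcut (Finset.mem_union_left _ hs))
  by_cases hel : e ∈ Q.lower c z
  · -- then `e ∈ c ∩ Tp` and the top piece is trivial
    have hec : e ∈ c := by
      rcases mem_lower.1 hel with h1 | h1
      · exact h1
      · exact absurd (hc.mem_above_of_mem_Tp he (mem_below.1 h1).2.1) (mem_below.1 h1).2.2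
    exact ⟨e, hec, Or.inr he, e, he, PathIn.refl (Set.mem_union_right _ (Set.mem_singleton _))⟩
  · -- follow the closed path down from `e` to its first site on or below `c`
    set R : Set (Site 2) := {y | y ∉ Q.lower c z} with hR
    obtain ⟨a, b, haR, hbR, -, hab, hpa⟩ := hq.symm.exit (R := R) hel (fun h' => h' hsl)
    have hbl : b ∈ Q.lower c z := not_not.1 hbR
    have haD : a ∈ Q.D := hpa.right_mem.2.1
    have haA : a ∈ Q.above c z := by
      by_contra haA
      exact haR ((mem_lower_iff_not_mem_above haD).2 haA)
    have hbc : b ∈ c := by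
      rcases mem_lower.1 hbl with h1 | h1
      · exact h1
      · exact absurd hab (not_adj_above_below haA h1)
    refine ⟨b, hbc, Or.inl ⟨a, haA, hab.symm⟩, e, he, ?_⟩
    refine (hpa.mono fun v hv => ?_).tail hab (Set.mem_union_right _ (Set.mem_singleton _))
    obtain ⟨hvR, hvD, hvω⟩ := hv
    have hvA : v ∈ Q.above c z := by
      by_contra hvA
      exact hvR ((mem_lower_iff_not_mem_above hvD).2 hvA)
    exact Set.mem_union_left _ ⟨hvA, fun hvω' => hvω ⟨hvω', fun hvl => hvR (Finset.mem_coe.1 hvl)⟩⟩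

/-- **Middle piece.** If `(c', z')` and `(c, z)` are consecutive terms of the exploration
sequence and `x ∈ c` is adjacent to the region above `c` (or on `Tp`), then some site `x' ∈ c'`
adjacent to the region above `c'` is joined to `x` by a path all of whose sites other than
`x', x` are closed sites below `c` and above `c'` ("there exists a vacant path from some
neighbor `w_i` of `v_i` to a neighbor `u_{i-1}` of `r_{i-1}`. The vacant piece from `w_i` to
`u_{i-1}` lies below `r_i` and above `r_{i-1}`"). [cite: KestenSidoraviciusZhang1998, App. §7 (7.10) p. 27] -/
theorem exists_closed_path_between (hcut : Q.CutProp) (hdual : Q.DualProp)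
    (h' : Q.lowestSeq ω u = some (c', z')) (h : Q.lowestSeq ω (u + 1) = some (c, z))
    (hx : x ∈ c) (hgood : (∃ y ∈ Q.above c z, triGraph.Adj x y) ∨ x ∈ Q.Tp) :
    ∃ x' ∈ c', (∃ y ∈ Q.above c' z', triGraph.Adj x' y) ∧
      PathIn triGraph ({y | y ∈ Q.below c z ∧ y ∈ Q.above c' z' ∧ y ∉ ω} ∪ {x', x}) x' x := by
  classical
  have hc' := (isCrossing_of_lowestSeq h').1
  obtain ⟨hcA, -, -⟩ := lowestSeq_succ_subset_above hcut h' h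
  have hxA' : x ∈ Q.above c' z' := hcA hx
  rw [lowestSeq_succ_of_eq_some h'] at h
  rcases exists_closed_path_to_lowest hcut hdual h hx hgood with hxBt | ⟨s, hs, y, hyx, hq⟩
  · exact absurd hxA' (hc'.not_mem_above_of_mem_Bt_union hcut (Finset.mem_union_left _ hxBt))
  · have hsD : s ∈ Q.D := Q.Bt_subset hs
    have hsl : s ∈ (↑(Q.lower c' z') : Set (Site 2)) := Finset.mem_coe.2
      ((mem_lower_iff_not_mem_above hsD).2
        (hc'.not_mem_above_of_mem_Bt_union hcut (Finset.mem_union_left _ hs)))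
    -- the last exit of the closed path from `lower c'`
    rcases hq.last_exit_or hsl with hyl | ⟨a, b, hal, -, hbl, hab, hpb⟩
    · -- the neighbour `y` of `x` is itself on `c'`
      have hyc' : y ∈ c' := by
        rcases mem_lower.1 (Finset.mem_coe.1 hyl) with h1 | h1
        · exact h1
        · exact absurd hyx.symm (not_adj_above_below hxA' h1)
      refine ⟨y, hyc', ⟨x, hxA', hyx⟩, PathIn.of_adj ?_ ?_ hyx⟩
      · exact Set.mem_union_right _ (Set.mem_insert _ _)
      · exact Set.mem_union_right _ (Set.mem_insert_of_mem _ (Set.mem_singleton _))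
    · have hbD : b ∈ Q.D := below_subset_D hpb.left_mem.1.1
      have hbA' : b ∈ Q.above c' z' := by
        by_contra hbA'
        exact hbl (Finset.mem_coe.2 ((mem_lower_iff_not_mem_above hbD).2 hbA'))
      have hac' : a ∈ c' := by
        rcases mem_lower.1 (Finset.mem_coe.1 hal) with h1 | h1
        · exact h1
        · exact absurd hab.symm (not_adj_above_below hbA' h1)
      have hp₂ : PathIn triGraph
          ({y | y ∈ Q.below c z ∧ y ∈ Q.above c' z' ∧ y ∉ ω} ∪ {a, x}) b y := by
        refine hpb.mono fun v hv => ?_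
        obtain ⟨⟨hvb, hvω⟩, hvl⟩ := hv
        have hvD : v ∈ Q.D := below_subset_D hvb
        have hvA' : v ∈ Q.above c' z' := by
          by_contra hvA'
          exact hvl (Finset.mem_coe.2 ((mem_lower_iff_not_mem_above hvD).2 hvA'))
        exact Set.mem_union_left _ ⟨hvb, hvA', fun hvω' => hvω ⟨hvω', hvl⟩⟩
      refine ⟨a, hac', ⟨b, hbA', hab⟩, ?_⟩
      exact (PathIn.of_adj (Set.mem_union_right _ (Set.mem_insert _ _)) hp₂.left_mem hab).trans
        (hp₂.tail hyx (Set.mem_union_right _ (Set.mem_insert_of_mem _ (Set.mem_singleton _))))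

/-- **Bottom piece.** If `(c, z)` is the first term of the exploration sequence and `x ∈ c` is
adjacent to the region above `c` (or on `Tp`), then `x` is joined to `Bt` by a path all of whose
sites other than `x` are closed sites below `c`. [cite: KestenSidoraviciusZhang1998, App. §7 (7.10) p. 27] -/
theorem exists_closed_path_from_Bt (hcut : Q.CutProp) (hdual : Q.DualProp)
    (h : Q.lowestSeq ω 0 = some (c, z)) (hx : x ∈ c)
    (hgood : (∃ y ∈ Q.above c z, triGraph.Adj x y) ∨ x ∈ Q.Tp) :
    ∃ s ∈ Q.Bt, PathIn triGraph ({y | y ∈ Q.below c z ∧ y ∉ ω} ∪ {x}) s x := by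
  rw [lowestSeq_zero] at h
  rcases exists_closed_path_to_lowest hcut hdual h hx hgood with hxBt | ⟨s, hs, y, hyx, hq⟩
  · exact ⟨x, hxBt, PathIn.refl (Set.mem_union_right _ (Set.mem_singleton _))⟩
  · exact ⟨s, hs, (hq.mono Set.subset_union_left).tail hyx
      (Set.mem_union_right _ (Set.mem_singleton _))⟩

/-! ### The transversal -/

/-- **The lower part of the transversal** (induction on the number of terms crossed): from a
site `x` of the `u`-th term adjacent to the region above it (or on `Tp`) down to `Bt`, through
one junction on each of the terms `0, …, u`, closed elsewhere. [cite: KestenSidoraviciusZhang1998, App. §7 (7.10) p. 27] -/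
theorem exists_transversal_below (hcut : Q.CutProp) (hdual : Q.DualProp) {u : ℕ} :
    ∀ {c : Finset (Site 2)} {z x : Site 2}, Q.lowestSeq ω u = some (c, z) → x ∈ c →
      ((∃ y ∈ Q.above c z, triGraph.Adj x y) ∨ x ∈ Q.Tp) →
      ∃ (T : Set (Site 2)) (jn : ℕ → Site 2), T ⊆ ↑Q.D ∧ jn u = x ∧
        (∃ s ∈ Q.Bt, PathIn triGraph T s x) ∧
        (∀ y ∈ T, y ∈ ω → ∃ u' ≤ u, y = jn u') ∧
        (∀ u' ≤ u, ∀ c' z', Q.lowestSeq ω u' = some (c', z') → jn u' ∈ c' ∧ jn u' ∈ T) := by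
  induction u with
  | zero =>
    intro c z x h hx hgood
    obtain ⟨s, hs, hp⟩ := exists_closed_path_from_Bt hcut hdual h hx hgood
    have hc := (isCrossing_of_lowestSeq h).1
    refine ⟨_, fun _ => x, ?_, rfl, ⟨s, hs, hp⟩, ?_, ?_⟩
    · rintro y (⟨hyb, -⟩ | hy)
      · exact Finset.mem_coe.2 (below_subset_D hyb)
      · rw [Set.mem_singleton_iff.1 hy]
        exact Finset.mem_coe.2 (hc.subset hx)
    · rintro y (⟨-, hyω⟩ | hy) hyω'
      · exact absurd hyω' hyω
      · exact ⟨0, le_rfl, Set.mem_singleton_iff.1 hy⟩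
    · intro u' hu' c' z' h'
      obtain rfl : u' = 0 := Nat.le_zero.1 hu'
      rw [h] at h'
      obtain ⟨rfl, rfl⟩ := Prod.mk.inj (Option.some.inj h')
      exact ⟨hx, Set.mem_union_right _ (Set.mem_singleton _)⟩
  | succ u ih =>
    intro c z x h hx hgood
    obtain ⟨⟨c', z'⟩, h'⟩ := exists_lowestSeq_eq_some_of_succ h
    obtain ⟨x', hx', hgood', hp₁⟩ := exists_closed_path_between hcut hdual h' h hx hgood
    obtain ⟨T₀, jn₀, hT₀D, hjn₀, ⟨s, hs, hp₀⟩, hopen₀, hterm₀⟩ := ih h' hx' (Or.inl hgood')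
    have hc := (isCrossing_of_lowestSeq h).1
    have hc' := (isCrossing_of_lowestSeq h').1
    refine ⟨T₀ ∪ ({y | y ∈ Q.below c z ∧ y ∈ Q.above c' z' ∧ y ∉ ω} ∪ {x', x}),
      Function.update jn₀ (u + 1) x, ?_, Function.update_self _ _ _,
      ⟨s, hs, (hp₀.mono Set.subset_union_left).trans (hp₁.mono Set.subset_union_right)⟩, ?_, ?_⟩
    · rintro y (hy | ⟨hyb, -, -⟩ | hy)
      · exact hT₀D hy
      · exact Finset.mem_coe.2 (below_subset_D hyb)
      · rcases hy with hy | hy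
        · rw [hy]; exact Finset.mem_coe.2 (hc'.subset hx')
        · rw [Set.mem_singleton_iff.1 hy]; exact Finset.mem_coe.2 (hc.subset hx)
    · rintro y (hy | ⟨-, -, hyω⟩ | hy) hyω'
      · obtain ⟨u', hu', rfl⟩ := hopen₀ y hy hyω'
        refine ⟨u', Nat.le_succ_of_le hu', ?_⟩
        rw [Function.update_of_ne (by omega)]
      · exact absurd hyω' hyω
      · rcases hy with hy | hy
        · refine ⟨u, Nat.le_succ u, ?_⟩
          rw [Function.update_of_ne (by omega), hjn₀]
          exact hy
        · refine ⟨u + 1, le_rfl, ?_⟩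
          rw [Function.update_self]
          exact Set.mem_singleton_iff.1 hy
    · intro u' hu' c'' z'' h''
      rcases Nat.lt_or_ge u' (u + 1) with hlt | hge
      · have hle : u' ≤ u := Nat.lt_succ_iff.1 hlt
        obtain ⟨h1, h2⟩ := hterm₀ u' hle c'' z'' h''
        rw [Function.update_of_ne (by omega)]
        exact ⟨h1, Set.mem_union_left _ h2⟩
      · obtain rfl : u' = u + 1 := le_antisymm hu' hge
        rw [h] at h''
        obtain ⟨rfl, rfl⟩ := Prod.mk.inj (Option.some.inj h'')
        rw [Function.update_self]
        exact ⟨hx, Set.mem_union_right _ (Set.mem_union_right _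
          (Set.mem_insert_of_mem _ (Set.mem_singleton _)))⟩

/-- **The closed transversal through the exploration sequence** (KSZ 1998, App. (7.10)): if the
exploration sequence of `ω` stops by step `t` (always the case for `t > #D`,
`lowestSeq_eq_none_of_card_lt`), there are a set of sites `T ⊆ D` carrying a `𝕋`-path from the
lower arc `Bt` to the upper arc `Tp`, and junctions `v u`, such that every open site of `T` is
the junction `v u` of some term `u` of the sequence, and for every term `(c_u, z_u)` the junction
`v u` lies on `c_u` and on `T` ("`τ` intersects each `r_i` in exactly one vertex `v_i`, and
except for these vertices `v_i`, `τ` is vacant"). [cite: KestenSidoraviciusZhang1998, App. §7 (7.10) p. 27] -/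
theorem exists_transversal (hcut : Q.CutProp) (hdual : Q.DualProp) {t : ℕ}
    (ht : Q.lowestSeq ω t = none) :
    ∃ (T : Set (Site 2)) (v : ℕ → Site 2), T ⊆ ↑Q.D ∧
      (∃ s ∈ Q.Bt, ∃ e ∈ Q.Tp, PathIn triGraph T s e) ∧
      (∀ y ∈ T, y ∈ ω → ∃ u c z, Q.lowestSeq ω u = some (c, z) ∧ y = v u) ∧
      (∀ u c z, Q.lowestSeq ω u = some (c, z) → v u ∈ c ∧ v u ∈ T) := by
  induction t with
  | zero =>
    rw [lowestSeq_zero] at ht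
    obtain ⟨s, hs, e, he, hp⟩ := exists_closed_path_of_lowest_eq_none hdual ht
    refine ⟨_, fun _ => s, fun y hy => Finset.mem_coe.2 hy.1, ⟨s, hs, e, he, hp⟩,
      fun y hy hyω => absurd hyω hy.2, fun u c z h => ?_⟩
    have h0 : Q.lowestSeq ω 0 = none := by rw [lowestSeq_zero]; exact ht
    rw [lowestSeq_eq_none_of_le h0 (Nat.zero_le u)] at h
    exact absurd h (by simp)
  | succ t ih =>
    cases h : Q.lowestSeq ω t with
    | none => exact ih h
    | some p =>
      obtain ⟨c, z⟩ := p
      obtain ⟨x, hx, hgood, e, he, hp₂⟩ := exists_closed_path_from_Tp hcut hdual h ht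
      obtain ⟨T₀, v, hT₀D, hvx, ⟨s, hs, hp₀⟩, hopen, hterm⟩ :=
        exists_transversal_below hcut hdual h hx hgood
      have hc := (isCrossing_of_lowestSeq h).1
      refine ⟨T₀ ∪ ({y | y ∈ Q.above c z ∧ y ∉ ω} ∪ {x}), v, ?_,
        ⟨s, hs, e, he, (hp₀.mono Set.subset_union_left).trans
          (hp₂.symm.mono Set.subset_union_right)⟩, ?_, ?_⟩
      · rintro y (hy | ⟨hyA, -⟩ | hy)
        · exact hT₀D hy
        · exact Finset.mem_coe.2 (above_subset_D hyA)
        · rw [Set.mem_singleton_iff.1 hy]; exact Finset.mem_coe.2 (hc.subset hx)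
      · rintro y (hy | ⟨-, hyω⟩ | hy) hyω'
        · obtain ⟨u', hu', rfl⟩ := hopen y hy hyω'
          cases h'' : Q.lowestSeq ω u' with
          | none =>
            rw [lowestSeq_eq_none_of_le h'' hu'] at h
            exact absurd h (by simp)
          | some q =>
            obtain ⟨c', z'⟩ := q
            exact ⟨u', c', z', h'', rfl⟩
        · exact absurd hyω' hyω
        · exact ⟨t, c, z, h, (Set.mem_singleton_iff.1 hy).trans hvx.symm⟩
      · intro u c' z' h'
        rcases Nat.lt_or_ge t u with hlt | hu
        · rw [lowestSeq_eq_none_of_le ht hlt] at h'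
          exact absurd h' (by simp)
        · obtain ⟨h1, h2⟩ := hterm u hu c' z' h'
          exact ⟨h1, Set.mem_union_left _ h2⟩

/-! ### The transversal separates `F` from `J` -/

/-- **A `Bt–Tp` path separates `F` from `J`**: if `T ⊆ D` carries a `𝕋`-path from `Bt` to
`Tp`, no `𝕋`-path of `D ∖ T` joins `F` to `J` (such a path would contain a crossing disjoint
from `T`, and crossings cut `Bt` from `Tp`: `CutProp`) ("`τ` separates the left edge of `S_R`
from its right edge"). [cite: KestenSidoraviciusZhang1998, App. §7 p. 27] -/
theorem not_pathIn_sdiff_of_transversal (hcut : Q.CutProp) {T : Set (Site 2)} (hTD : T ⊆ ↑Q.D)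
    {s e : Site 2} (hs : s ∈ Q.Bt) (he : e ∈ Q.Tp) (hT : PathIn triGraph T s e)
    {f j : Site 2} (hf : f ∈ Q.F) (hj : j ∈ Q.J) :
    ¬ PathIn triGraph (↑Q.D \ T) f j := by
  classical
  intro hp
  set S : Finset (Site 2) := Q.D.filter fun y => y ∉ T with hS
  have hSD : S ⊆ Q.D := Finset.filter_subset _ _
  have hp' : PathIn triGraph (↑S : Set (Site 2)) f j := hp.mono fun y hy => by
    simp only [hS, Finset.coe_filter, Set.mem_setOf_eq]
    exact ⟨Finset.mem_coe.1 hy.1, hy.2⟩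
  obtain ⟨c, z, hc, hcS⟩ := exists_crossing_subset hSD hf hj hp'
  refine hcut hc s (Finset.mem_union_left _ hs) e (Finset.mem_union_left _ he)
    (hT.mono fun y hy => ?_)
  simp only [Finset.coe_sdiff, Set.mem_sdiff, Finset.mem_coe]
  exact ⟨Finset.mem_coe.1 (hTD hy), fun hyc => (Finset.mem_filter.1 (hcS hyc)).2 hy⟩

/-- **Left of `τ`, right of `τ`.** With `T` as above, a site joined to `F` inside `D ∖ T` and a
site joined to `J` inside `D ∖ T` are distinct and not adjacent ("the piece of `s_q` till it
reaches `v_{i_q}` lies to the 'left of `τ`' and cannot intersect the piece of some `r_j` … from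
`v_j` to `a(r_j)`, because this lies to the 'right of `τ`'"). [cite: KestenSidoraviciusZhang1998, App. §7 p. 27] -/
theorem ne_and_not_adj_of_transversal (hcut : Q.CutProp) {T : Set (Site 2)} (hTD : T ⊆ ↑Q.D)
    {s e : Site 2} (hs : s ∈ Q.Bt) (he : e ∈ Q.Tp) (hT : PathIn triGraph T s e)
    {f j a b : Site 2} (hf : f ∈ Q.F) (hj : j ∈ Q.J)
    (ha : PathIn triGraph (↑Q.D \ T) f a) (hb : PathIn triGraph (↑Q.D \ T) b j) :
    a ≠ b ∧ ¬ triGraph.Adj a b := by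
  constructor
  · rintro rfl
    exact not_pathIn_sdiff_of_transversal hcut hTD hs he hT hf hj (ha.trans hb)
  · intro hab
    exact not_pathIn_sdiff_of_transversal hcut hTD hs he hT hf hj ((ha.tail hab hb.left_mem).trans hb)

/-- **Every `F–J` path of `D` meets the transversal, first at one of its sites adjacent to the
part of the path before it**: if `T ⊆ D` carries a `Bt–Tp` path, a `𝕋`-path inside `A ⊆ D` from
`f ∈ F` to `j ∈ J` either starts on `T`, or reaches a site `b ∈ T ∩ A` from a site `a ∉ T`
joined to `f` inside `A ∖ T` ("each `s_q` must intersect `τ` in some point … Let the first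
intersection of `s_q` with `τ` be at `v_{i_q}`"). [cite: KestenSidoraviciusZhang1998, App. §7 p. 27] -/
theorem exists_first_visit_of_transversal (hcut : Q.CutProp) {T : Set (Site 2)} (hTD : T ⊆ ↑Q.D)
    {s e : Site 2} (hs : s ∈ Q.Bt) (he : e ∈ Q.Tp) (hT : PathIn triGraph T s e)
    {A : Set (Site 2)} (hA : A ⊆ ↑Q.D) {f j : Site 2} (hf : f ∈ Q.F) (hj : j ∈ Q.J)
    (hp : PathIn triGraph A f j) :
    f ∈ T ∨ ∃ a b, a ∉ T ∧ b ∈ T ∧ b ∈ A ∧ triGraph.Adj a b ∧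
      PathIn triGraph ({y | y ∉ T} ∩ A) f a := by
  by_cases hfT : f ∈ T
  · exact Or.inl hfT
  right
  rcases hp.exit_or (R := {y | y ∉ T}) hfT with hq | ⟨a, b, haT, hbT, hbA, hab, hq⟩
  · have hq' : PathIn triGraph (↑Q.D \ T) f j := hq.mono fun y hy => ⟨hA hy.2, hy.1⟩
    exact absurd hq' (not_pathIn_sdiff_of_transversal hcut hTD hs he hT hf hj)
  · exact ⟨a, b, haT, not_not.1 hbT, hbA, hab, hq⟩

end JDomain

end Literature.Probability.Percolation
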